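import Summits.AtomisticToContinuum.BoseEinsteinCondensation.Theorems.BECThomsonPrincipleGaussianDominationCanDefs
import HarnessLib

/-!
# Crux-strategist s1 sketch — typed signatures for `STRATEGY-CENSUS.md` (gen 2, 2026-08-17),
# crux `GaussianDominationCan` (stmt-AtomisticToContinuum-9479, route `BECThomsonPrinciple`)

Statements only (`def … : Prop`) plus trivial placements.  Nothing here is a line, a stub or an item;
these are the signatures the census (`Cruxes/GaussianDominationCan/STRATEGY-CENSUS.md`, §G/§S/§D/§N)
argues about.  Companion of the gen-1 file `StrategistSketch.lean` (namespace `…Strategist`), whose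
`GDCanGerm`, `ChordAutomatic`, `ExcessControlsMode`, `QuantGerm`, `GPAnchor`, `ScaleExtension` are
referred to by name and not re-declared.

Vocabulary: `Negative.{ProductCalculus,CruxForms}` (`theta`, `phase`, `sourceIntegral`, `nsq`, `GDIneq`,
`InWindow`, `GDCanWith`) and the coupling line's `Defs` (`modeCoeff`, `IsSourcedNearMin`).
Units `ħ = 2m = 1`; `k = 2πn/L`, `‖n‖` the SUP norm, `nsq n = Σ n_j²`.
-/

noncomputable section

namespace Summit.AtomisticToContinuum.BoseEinsteinCondensation.Cruxes.GaussianDominationCan.StrategistS1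

open MeasureTheory
open scoped ENNReal NNReal ComplexConjugate
open Literature.MathematicalPhysics.QuantumManyBody.BoseGas
open Summit.AtomisticToContinuum.BoseEinsteinCondensation.Theses
open Summit.AtomisticToContinuum.BoseEinsteinCondensation.Theorems.GaussianDominationCan.Negative
  (GDIneq InWindow GDCanWith gaussianDominationCan_iff sourceIntegral theta phase nsq)
open Summit.AtomisticToContinuum.BoseEinsteinCondensation.Cruxes.GaussianDominationCan.CouplingMonotoneChord
  (modeCoeff IsSourcedNearMin trunc)

/-! ## §G  The GERM of the crux, `s`-free: the rank-two operator (bilinear) form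

`H − E₀ ≥ (k²/(4π²C)) · (|Λ_k†Ψ₀⟩⟨Λ_k†Ψ₀| + |Λ_kΨ₀⟩⟨Λ_kΨ₀|)` as a quadratic-form inequality tested on
trial states `η`, i.e. `|⟨η, Λ_k†Ψ₀⟩|² + |⟨η, Λ_kΨ₀⟩|² ≤ (4π²C/k²)·(E(η) − E₀)`.  By the Riesz / Thomson
duality `⟨f,(H−E₀)⁻¹f⟩ = sup_η |⟨f,η⟩|²/⟨η,(H−E₀)η⟩` this is EQUIVALENT to the static susceptibility bound
`χ_Λ ≤ 16π²C/k²`, hence (Kato radius at fixed `N, L`) to the `∃ s₀` germ `Strategist.GDCanGerm` up to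
constants; it is exactly what ONE admissible Thomson flow over `Ψ₀²` certifies (the route's mechanism,
`Literature…WeightedThomsonPrinciple.hMinusOneSqW_le_of_flux`) and exactly what variational `T = 0` KLS
(`GDTransfer`, `Φ_t = Ψ₀ + tζ`, `t → 0`) consumes.  `⟨η, Λ_k†Ψ⟩ = (m+1)·crossIntegral η Ψ` by Bose symmetry. -/

/-- The cross source integral `⟨η, e^{ik·x₀} Θ_ψ⟩ = ∫ conj(η) e^{ik·x₀} (P₀ n̂₀^{-1/2} ψ)`; its diagonal is
the crux's `sourceIntegral`. -/
def crossIntegral (m : ℕ) (L : ℝ) (n : Fin 3 → ℤ) (η ψ : Config (m + 1) → ℂ) : ℂ :=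
  ∫ X in cellN (m + 1) L, conj (η X) * phase m L n X * theta m L ψ X

/-- The diagonal of the cross integral is the crux's source integral (definitional). [folklore] -/
theorem crossIntegral_self (m : ℕ) (L : ℝ) (n : Fin 3 → ℤ) (ψ : Config (m + 1) → ℂ) :
    crossIntegral m L n ψ ψ = sourceIntegral m L n ψ := rfl

/-- `GermBilinear` with constants exposed: for every exact minimiser `Ψ` and every trial state `η`,
`E₀ + (m+1)²(|cross η Ψ|² + |cross Ψ η|²)·(4π² nsq n/L²)/C ≤ E(η)`.  (At `η = Ψ` it contains
`⟨Ψ₀, Λ_k†Ψ₀⟩ = 0`: momentum conservation of the translation-invariant minimiser.) -/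
def GermBilinearWith (ρ₀ C : ℝ) (N₀ : ℕ) (v : ℝ → ℝ≥0∞) (M : ℝ) : Prop :=
  ∀ m : ℕ, N₀ ≤ m + 1 → ∀ L : ℝ, 0 < L → ((m + 1 : ℕ) : ℝ) ≤ ρ₀ * L ^ 3 →
    ∀ n : Fin 3 → ℤ, n ≠ 0 → InWindow M m L n →
      ∀ Ψ : PeriodicTrialState (m + 1) L,
        periodicEnergy v Ψ = periodicGroundStateEnergy v (m + 1) L →
          ∀ η : PeriodicTrialState (m + 1) L,
            periodicGroundStateEnergy v (m + 1) L +
                ENNReal.ofReal ((((m + 1 : ℕ) : ℝ) ^ 2 *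
                    (‖crossIntegral m L n η.ψ Ψ.ψ‖ ^ 2 + ‖crossIntegral m L n Ψ.ψ η.ψ‖ ^ 2)) *
                  (4 * Real.pi ^ 2 * nsq n / L ^ 2) / C) ≤
              periodicEnergy v η

/-- **GermBilinear** — the `s`-free germ of the crux (the recommended conclusion of BOTH item 9479's
re-typing and the glue item `GDCanOfFlows` 14723; see the census §R). -/
def GermBilinear : Prop :=
  ∀ v : ℝ → ℝ≥0∞, IsRepulsiveFiniteRange v → ∀ M : ℝ, 0 < M →
    ∃ ρ₀ C : ℝ, 0 < ρ₀ ∧ 0 < C ∧ ∃ N₀ : ℕ, GermBilinearWith ρ₀ C N₀ v M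

/-- **GermBilinearTrunc** — the germ with constants UNIFORM along the bounded truncations `min(v, h)`
of each admissible `v` (for bounded `v` it contains `GermBilinear v`: `trunc v h = v` once `h ≥ sup v`).
This is the recommended re-typing (census §R): (i) every instance is a BOUNDED potential, whose exact
minimisers are `C^{1,α}` and positive (no vacuity, flows apply); (ii) `T = 0` KLS consumes it in ONE
Cauchy–Schwarz step (`m₀² ≤ (2C/k²)·m₁` with `η ∝ (Λ_k+Λ_k†)Ψ₀`, or a contact-cut-off `η` for the
hard-core limit `h → ∞`), no `t → 0`, no Kato radius; (iii) the `h`-uniformity is what `GDCanOfFlows`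
step (v) asks of the mechanism cruxes anyway. -/
def GermBilinearTrunc : Prop :=
  ∀ v : ℝ → ℝ≥0∞, IsRepulsiveFiniteRange v → ∀ M : ℝ, 0 < M →
    ∃ ρ₀ C : ℝ, 0 < ρ₀ ∧ 0 < C ∧ ∃ N₀ : ℕ, ∀ h : ℝ, 0 < h → GermBilinearWith ρ₀ C N₀ (trunc v h) M

/-- **RayExtension** (the ONLY shape a complement of the germ can take — census §D-A; NOT filed): linear
response uniformly bounded ⇒ the chord for every `s ≥ 0`.  Its content is the non-linear (sourced)
response `s₀ < s ≲ √N k²`, for which no `E₀`-free tool exists (no positive sourced minimiser) and which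
no item of the route consumes once `closes` runs through the germ. -/
def RayExtension : Prop :=
  GermBilinearTrunc → BECThomsonPrinciple.GaussianDominationCan

/-- The bridge split is modus ponens (recorded to show the seam is trivial and the difficulty sits
entirely in the two leaves). [folklore] -/
theorem gaussianDominationCan_of_germ_of_ray (hG : GermBilinearTrunc) (hR : RayExtension) :
    BECThomsonPrinciple.GaussianDominationCan :=
  hR hG

/-! ## §S  Strengthening S⁺: the tangent chord from EVERY sourced base point

`e(s) := inf_Φ [E(Φ) − s·J(Φ)]`, `J = 2(m+1)|I|`, is concave; the crux is `e(s) ≥ e(0) − C s²/k̃²`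
(tangent chord at the base point `s₀ = 0`, where `J(Ψ₀) = 0`).  S⁺ asks the same from every base point:
`e(s) ≥ e(s₀) − (s − s₀)·J(Ψ_{s₀}) − C (s − s₀)²/k̃²` for (near-)minimisers `Ψ_{s₀}` of the sourced
functional — a UNIFORM SEMICONCAVITY MODULUS of `e`, i.e. `χ_Λ(Ψ_s) ≤ 2C/k̃²` for all driven ground
states.  Unfolded over trial states it reads as below (no infima, no subtraction). -/

/-- `TangentChord` with constants exposed. The instance `s₀ = 0`, `δ → 0` is the crux up to the folklore
step `J(Ψ_δ) → 0` for near-minimisers of momentum zero. -/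
def TangentChordWith (ρ₀ C : ℝ) (N₀ : ℕ) (v : ℝ → ℝ≥0∞) (M : ℝ) : Prop :=
  ∀ m : ℕ, N₀ ≤ m + 1 → ∀ L : ℝ, 0 < L → ((m + 1 : ℕ) : ℝ) ≤ ρ₀ * L ^ 3 →
    ∀ n : Fin 3 → ℤ, n ≠ 0 → InWindow M m L n → ∀ s₀ : ℝ, 0 ≤ s₀ → ∀ δ : ℝ, 0 ≤ δ →
      ∀ Ψ : PeriodicTrialState (m + 1) L, IsSourcedNearMin v m L n s₀ δ Ψ →
        ∀ s : ℝ, 0 ≤ s → ∀ Φ : PeriodicTrialState (m + 1) L,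
          periodicEnergy v Ψ + ENNReal.ofReal (s * (2 * (m + 1) * ‖sourceIntegral m L n Φ.ψ‖)) ≤
            periodicEnergy v Φ + ENNReal.ofReal (s * (2 * (m + 1) * ‖sourceIntegral m L n Ψ.ψ‖)) +
              ENNReal.ofReal (C * (s - s₀) ^ 2 * L ^ 2 / ‖(fun j => (n j : ℝ))‖ ^ 2) +
                ENNReal.ofReal δ

/-- **S⁺ TangentChord** (lens `strengthen`): uniform semiconcavity of the sourced ground-state energy
along the whole ray.  Why no leverage: its surplus over the crux sits at base points `s₀ > 0`, whose
minimisers are complex (the sourced Hamiltonian is stoquastic in no natural basis, lead c7 §1(b)) — no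
ground-state representation, no flow, no Perron–Frobenius; and it forbids kinks of `e` (first-order
rearrangements of the driven condensate), which the crux tolerates and nothing excludes. -/
def TangentChord : Prop :=
  ∀ v : ℝ → ℝ≥0∞, IsRepulsiveFiniteRange v → ∀ M : ℝ, 0 < M →
    ∃ ρ₀ C : ℝ, 0 < ρ₀ ∧ 0 < C ∧ ∃ N₀ : ℕ, TangentChordWith ρ₀ C N₀ v M

/-! ## §D  Decomposition of the GERM in the phonon window by Feynman's bound in the momentum sector

`χ_Λ ≤ 2‖Λ_k†Ψ₀‖²/gap₊(k) + 2‖Λ_kΨ₀‖²/gap₋(k)`, `‖Λ_k†Ψ₀‖² = 1 + n_k(Ψ₀)`, `‖Λ_kΨ₀‖² = n_k(Ψ₀)`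
(`m₋₁ ≤ m₀/gap` in the Bloch sector `P = ±k`).  Leaves: a one-mode `T = 0` infrared bound for the
minimiser and a yrast (sector-gap) floor; they give `χ_Λ ≤ C/k²` exactly when `k ≲ √ρ` (phonon window);
in the particle window `kξ ≫ 1` the cheapest momentum-`k` states are multi-phonon states of energy
`c_s k ≪ k²`, and the bound misses `1/k²` by the factor `kξ` — there the germ needs the SPECTRAL WEIGHT
of `Λ_k†Ψ₀` at `ω ≳ k²` (quasi-particle sharpness, beyond BEC).  Cross-route: the leaves are the
periodic-minimiser forms of `BECTwoSectorGD.PeriodicInfraredBound` (stmt-12624) /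
`BECInfraredBound.BecIrWindow` (stmt-8911) and of `BECNoCheapMomentum.SectorGapFloor` (stmt-11843). -/

/-- **OneModeIRBound** (leaf 1): `n_k(Ψ₀) = (m+1)∫|ĉ_k|² ≤ K(1 + √ρ·L/(2π‖n‖))` for every exact
minimiser, uniformly down the density scale (Bogoliubov/Gavoret–Nozières `≈ √(πρa)/|k|`). OPEN (no
continuum IR bound without reflection positivity). -/
def OneModeIRBoundWith (ρ₀ K : ℝ) (N₀ : ℕ) (v : ℝ → ℝ≥0∞) (M : ℝ) : Prop :=
  ∀ m : ℕ, N₀ ≤ m + 1 → ∀ L : ℝ, 0 < L → ((m + 1 : ℕ) : ℝ) ≤ ρ₀ * L ^ 3 →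
    ∀ n : Fin 3 → ℤ, n ≠ 0 → InWindow M m L n →
      ∀ Ψ : PeriodicTrialState (m + 1) L,
        periodicEnergy v Ψ = periodicGroundStateEnergy v (m + 1) L →
          ENNReal.ofReal ((m + 1 : ℕ) : ℝ) *
              ∫⁻ X in cellN (m + 1) L, (‖modeCoeff m L n Ψ.ψ X‖₊ : ℝ≥0∞) ^ 2 ≤
            ENNReal.ofReal (K * (1 + Real.sqrt ((m + 1 : ℕ) / L ^ 3) * L /
              (2 * Real.pi * ‖(fun j => (n j : ℝ))‖)))

def OneModeIRBound : Prop :=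
  ∀ v : ℝ → ℝ≥0∞, IsRepulsiveFiniteRange v → ∀ M : ℝ, 0 < M →
    ∃ ρ₀ K : ℝ, 0 < ρ₀ ∧ 0 < K ∧ ∃ N₀ : ℕ, OneModeIRBoundWith ρ₀ K N₀ v M

/-- **YrastFloor** (leaf 2): the least energy of a Bloch-`k` periodic state exceeds `E₀` by
`c · min(k², k√ρ)` (phonon `c_s k` below `1/ξ`, free `k²` above), uniformly down the density scale —
the canonical (fixed-`N`) form of `BECNoCheapMomentum.SectorGapFloor`. OPEN. -/
def YrastFloorWith (ρ₀ c : ℝ) (N₀ : ℕ) (v : ℝ → ℝ≥0∞) (M : ℝ) : Prop :=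
  ∀ m : ℕ, N₀ ≤ m + 1 → ∀ L : ℝ, 0 < L → ((m + 1 : ℕ) : ℝ) ≤ ρ₀ * L ^ 3 →
    ∀ n : Fin 3 → ℤ, n ≠ 0 → InWindow M m L n →
      periodicGroundStateEnergy v (m + 1) L +
          ENNReal.ofReal (c * min ((2 * Real.pi * ‖(fun j => (n j : ℝ))‖ / L) ^ 2)
            ((2 * Real.pi * ‖(fun j => (n j : ℝ))‖ / L) * Real.sqrt ((m + 1 : ℕ) / L ^ 3))) ≤
        ⨅ (Ψ : PeriodicTrialState (m + 1) L)
          (_ : ∀ (τ : Space) (X : Config (m + 1)),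
            Ψ.ψ (fun i => X i + τ) =
              Complex.exp (Complex.I * ↑(2 * Real.pi / L * ∑ j, (n j : ℝ) * τ j)) * Ψ.ψ X),
          periodicEnergy v Ψ

def YrastFloor : Prop :=
  ∀ v : ℝ → ℝ≥0∞, IsRepulsiveFiniteRange v → ∀ M : ℝ, 0 < M →
    ∃ ρ₀ c : ℝ, 0 < ρ₀ ∧ 0 < c ∧ ∃ N₀ : ℕ, YrastFloorWith ρ₀ c N₀ v M

/-- The germ restricted to the PHONON window `k² ≤ 8π a ρ` (`kξ ≤ 1`; `a` = scattering length). -/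
def GermBilinearPhonon : Prop :=
  ∀ v : ℝ → ℝ≥0∞, IsRepulsiveFiniteRange v → ∀ M : ℝ, 0 < M →
    ∃ ρ₀ C : ℝ, 0 < ρ₀ ∧ 0 < C ∧ ∃ N₀ : ℕ,
      ∀ m : ℕ, N₀ ≤ m + 1 → ∀ L : ℝ, 0 < L → ((m + 1 : ℕ) : ℝ) ≤ ρ₀ * L ^ 3 →
        ∀ n : Fin 3 → ℤ, n ≠ 0 → InWindow M m L n →
          (2 * Real.pi * ‖(fun j => (n j : ℝ))‖ / L) ^ 2 ≤
              8 * Real.pi * (scatteringLength v).toReal * ((m + 1 : ℕ) / L ^ 3) →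
            ∀ Ψ : PeriodicTrialState (m + 1) L,
              periodicEnergy v Ψ = periodicGroundStateEnergy v (m + 1) L →
                ∀ η : PeriodicTrialState (m + 1) L,
                  periodicGroundStateEnergy v (m + 1) L +
                      ENNReal.ofReal ((((m + 1 : ℕ) : ℝ) ^ 2 *
                          (‖crossIntegral m L n η.ψ Ψ.ψ‖ ^ 2 + ‖crossIntegral m L n Ψ.ψ η.ψ‖ ^ 2)) *
                        (4 * Real.pi ^ 2 * nsq n / L ^ 2) / C) ≤
                    periodicEnergy v η

/-- **Split D-B (paper glue = Feynman's sector bound; NOT filed)**: the two open leaves give the germ in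
the phonon window only; the particle window and the non-linear ray remain. -/
def PhononGermSplit : Prop :=
  OneModeIRBound → YrastFloor → GermBilinearPhonon

/-- The germ restricts to the phonon window (drop a hypothesis). [folklore] -/
theorem germBilinearPhonon_of_germBilinear (h : GermBilinear) : GermBilinearPhonon := by
  intro v hv M hM
  obtain ⟨ρ₀, C, hρ₀, hC, N₀, hG⟩ := h v hv M hM
  exact ⟨ρ₀, C, hρ₀, hC, N₀, fun m hm L hL hd n hn hw _ Ψ hΨ η => hG m hm L hL hd n hn hw Ψ hΨ η⟩

end Summit.AtomisticToContinuum.BoseEinsteinCondensation.Cruxes.GaussianDominationCan.StrategistS1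

end
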